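/-
Copyright (c) 2026 the pub-hodgecm-mathlib formalisation cell (harness21).  Prover seat hodgecm-mathlib-K2E1-p16 (g3), Track B «K2-LIT» ENGINE E1, h413 = `stmt-HodgeConjecture-24833`,
route `HCCMUnconditional`, R90-S8 «ContSpec-n½», deal of the S8 section report #2 (F) (S8 dealer R90-CS-plan (g3)): the (V) row `hA32` DISCHARGED BY NAME on the UNIT-COUPLING blocks
of record — ★ `hA32_of_record` at the block's coupling exponent `m_w = kμ,w − 2eη,w` (★ `lastRowChar_infiniteIdeles_midBlock`), leaving `hm1` and the finite half `hA32f` visible.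
-/
import Summits.HodgeConjecture.HodgeConjecture.Theorems.K2E1ChiArchA32OfRecordU3       -- ★ p863956 (R90-CS-p03): `hA32_of_record`, `arch_integral_of_record_ne_zero`
import Summits.HodgeConjecture.HodgeConjecture.Theorems.K2E1ArchSectionLOnBigCellU3    -- ★ p863894 (K2E1-p13): `lastRowChar_infiniteIdeles_midBlock` (the `m_w` table `m_w = kμ,w − 2·ξ.eη w`), `OneDimAutRepH.eη`
import HarnessLib

/-!
# h413 ∕ R90-S8 — `K2E1ChiArchA32UnitCouplingOfRecordU3`: ★ F5's `hA32` ON THE UNIT-COUPLING BLOCKS OF RECORD, BY NAME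

Cell `pub/hodgecm-mathlib`, crux H413 = `stmt-HodgeConjecture-24833`; S8 dealer R90-CS-plan (g3), section report #2 (F) «K2E1-p16 NEXT = `K2E1ChiArchA32UnitCouplingOfRecordU3` (S)».
Consumer: the F5 block `(A hA hsrc hA32)` of the (V) OF RECORD ∕ OF LEDGER files (★ p863986∕p864046 `R90S8ResGMidBlockNeBot{OfRecord,OfLedger}U3` :109–:113) and of the (R)′ OF RECORD
(★ p863946), with the NAMING OF RECORD of `A` (★ p863956 `K2E1ChiArchA32OfRecordU3`, module docstring): `A z := C_f z · ∫_{L_∞}∫_{L⁺_∞} (u·∏_w archUnitaryValue (m_w) 0 ζ_w(Ξ,a))·ARCH₃(Ξ,a)^{−z}`.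
THEOREMS ONLY (no `def`, no `instance`, no notation, no named-fact hypothesis, no `sorry`; default heartbeats); lane `--supports stmt-HodgeConjecture-24833 --as helper` (count-neutral).

THE MATHEMATICS ([MoeglinWaldspurger1995, II.1.7, IV.1.11]; [Rogawski1990, §13.9 p. 229]; [Langlands1976, Appendix]).  ★ `hA32_of_record` proves `A (3∕2) ≠ 0` from three visible letters:
the COUPLING RANGE `hm : ∀ w, |m_w| ≤ 2`, the unit constant `hu : u ≠ 0`, and the finite half `hA32f : C_f (3∕2) ≠ 0`.  On a block of record `(ξ, μω)` with `μω` of unitary archimedean type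
`(kμ, 0)` the archimedean last-row character is `∏_w archUnitaryValue (kμ,w − 2·eη,w) 0 (·)` (★ `lastRowChar_infiniteIdeles_midBlock`: **`m_w = kμ,w − 2·ξ.eη w`**, `t_w = 0`; `kμ,w` odd), so
on the UNIT-COUPLING blocks (ruling J-S8-∞‴: `hm1 : |kμ,w − 2·eη,w| = 1` at every place) the range letter is AUTOMATIC (`1 ≤ 2`), and the unit constant `u = χ₂,∞(det ι(w₀))` is a value
of a unitary character, so `‖u‖ = 1 ⇒ u ≠ 0`.  Hence:
* §1 **`hA32_unitCoupling_of_record`** — `A (3∕2) ≠ 0` for the amplitude of record AT `m := kμ − 2·ξ.eη`, from `hm1`, `‖u‖ = 1`, `hA32f` (★ `hA32_of_record` by name);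
  **`arch_integral_unitCoupling_ne_zero`** — the archimedean double integral alone is `≠ 0` (★ `arch_integral_of_record_ne_zero`).
* §2 **`abs_le_two_of_abs_eq_one`**, **`ne_zero_of_norm_eq_one`** — the two one-line letter conversions, exported for the OF-RECORD consumers.
WHAT STAYS VISIBLE (honest, named): `hm1 : ∀ w, |kμ w − 2·ξ.eη w| = 1` (unit coupling — the blocks with `|m_w| ≥ 3` are the (∞-2) SHIFTED-WITNESS estate, K2E1-p13), `hu1 : ‖u‖ = 1` (trivial at
the consumer: `u` is a unitary character value), `hA32f : C_f (3∕2) ≠ 0` (the finite half — R90-C10-p07 ∕ R90-CS-p03's `hA32f` file).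
HONEST LABEL: HC_CM is proved only modulo the 7 printed citations (2 remaining named inputs: hLiu418 = `stmt-HodgeConjecture-24832`, h413 = `stmt-HodgeConjecture-24833`) until rung 0
closes; this file asserts no named fact and closes no socket; count-neutral.

## References
* [MoeglinWaldspurger1995] C. Mœglin, J.-L. Waldspurger, *Spectral Decomposition and Eisenstein Series* (1995), II.1.7, IV.1.11.
* [Rogawski1990] J. D. Rogawski, *Automorphic Representations of Unitary Groups in Three Variables* (1990), §13.9 (p. 229).
* [Langlands1976] R. P. Langlands, *On the Functional Equations Satisfied by Eisenstein Series*, LNM 544 (1976), Appendix.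
-/

set_option autoImplicit false
-- the mandated namespace repeats the single-problem summit's segment (`HodgeConjecture.HodgeConjecture`)
set_option linter.dupNamespace false

noncomputable section

open MeasureTheory MeasureTheory.Measure NumberField NumberField.InfinitePlace
open Literature.NumberTheory.GaloisRepresentations (archUnitaryValue)
open Literature.NumberTheory.Rogawski1990
open Summit.HodgeConjecture.HodgeConjecture.Cruxes.H413
open Summit.HodgeConjecture.HodgeConjecture.Cruxes.H413.K2E1ChiArchA32OfRecordU3 (hA32_of_record arch_integral_of_record_ne_zero)

namespace Summit.HodgeConjecture.HodgeConjecture.Cruxes.H413.K2E1ChiArchA32UnitCouplingOfRecordU3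

/-! ## §2 (stated first) The two letter conversions -/

/-- Unit coupling is in the coupling range: `|n| = 1 ⇒ |n| ≤ 2`. [folklore] -/
theorem abs_le_two_of_abs_eq_one {ι : Type*} {n : ι → ℤ} (h : ∀ i, |n i| = 1) : ∀ i, |n i| ≤ 2 :=
  fun i => by rw [h i]; norm_num

/-- A complex number of norm `1` is non-zero. [folklore] -/
theorem ne_zero_of_norm_eq_one {u : ℂ} (hu : ‖u‖ = 1) : u ≠ 0 :=
  norm_ne_zero_iff.1 (by rw [hu]; exact one_ne_zero)

/-! ## §1 `hA32` on the unit-coupling blocks of record -/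

section UnitCoupling

variable (L : Type) [Field L] [NumberField L] [IsCMField L] {δ : L} (hcδ : IsCMField.complexConj L δ = -δ) (hδ : δ ≠ 0)
  [MeasurableSpace (InfiniteAdeleRing L)] [BorelSpace (InfiniteAdeleRing L)]
  [MeasurableSpace (InfiniteAdeleRing ↥(maximalRealSubfield L))] [BorelSpace (InfiniteAdeleRing ↥(maximalRealSubfield L))]
  (μE₁ : Measure (InfiniteAdeleRing L)) [μE₁.IsAddHaarMeasure] (μF₁ : Measure (InfiniteAdeleRing ↥(maximalRealSubfield L))) [μF₁.IsAddHaarMeasure]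

include hcδ hδ in
/-- **THE ARCHIMEDEAN DOUBLE INTEGRAL OF THE BLOCK OF RECORD IS NON-ZERO AT `3∕2` ON A UNIT-COUPLING BLOCK**: at the coupling exponent `m_w = kμ,w − 2·ξ.eη w` of ★
`lastRowChar_infiniteIdeles_midBlock` with `hm1 : |kμ,w − 2·ξ.eη w| = 1` and a unit constant with `‖u‖ = 1`: `∫_{L_∞}∫_{L⁺_∞} (u·∏_w archUnitaryValue (m_w) 0 ζ_w)·ARCH₃^{−3∕2} ≠ 0`
(★ `arch_integral_of_record_ne_zero` by name). [cite: MoeglinWaldspurger1995, II.1.7, IV.1.11] [cite: Rogawski1990, §13.9 p. 229] -/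
theorem arch_integral_unitCoupling_ne_zero (ξ : OneDimAutRepH L) (kμ : InfinitePlace L → ℤ) (hm1 : ∀ w, |kμ w - 2 * ξ.eη w| = 1) (u : ℂ) (hu1 : ‖u‖ = 1) :
    (∫ Xi : InfiniteAdeleRing L, ∫ a : InfiniteAdeleRing ↥(maximalRealSubfield L),
      (u * ∏ w : InfinitePlace L, archUnitaryValue (kμ w - 2 * ξ.eη w) 0 ((((-(1 + ‖Xi w‖ ^ 2 / 2)) : ℝ) : ℂ) +
          (((w.embedding δ).im * ((InfiniteAdeleRing.ringEquiv_mixedSpace ↥(maximalRealSubfield L)) a).1 ⟨w.comap (algebraMap ↥(maximalRealSubfield L) L), K2E1HeightBigCellLineFormulaU2.isReal_comap_maximalRealSubfield L w⟩ : ℝ) : ℂ) * Complex.I)) *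
        ((((∏ w : InfinitePlace L, ((1 + ‖(Xi) w‖ ^ 2 / 2) ^ 2 + (w δ) ^ 2 * (((InfiniteAdeleRing.ringEquiv_mixedSpace ↥(maximalRealSubfield L)) a).1 ⟨w.comap (algebraMap ↥(maximalRealSubfield L) L), K2E1HeightBigCellLineFormulaU2.isReal_comap_maximalRealSubfield L w⟩) ^ 2))) : ℝ) : ℂ) ^ (-(3 / 2 : ℂ)) ∂μF₁ ∂μE₁) ≠ 0 :=
  arch_integral_of_record_ne_zero L hcδ hδ μE₁ μF₁ (fun w => kμ w - 2 * ξ.eη w) (abs_le_two_of_abs_eq_one hm1) u (ne_zero_of_norm_eq_one hu1)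

include hcδ hδ in
/-- **HEAD.  ★ F5's `hA32` ON THE UNIT-COUPLING BLOCKS OF RECORD, BY NAME**: for the block `(ξ, μω)` (`μω` of unitary type `(kμ, 0)`, coupling exponent `m := kμ − 2·ξ.eη` by ★
`lastRowChar_infiniteIdeles_midBlock`) with UNIT COUPLING `hm1 : ∀ w, |kμ w − 2·ξ.eη w| = 1`, a unit constant `‖u‖ = 1` and the finite half `hA32f : C_f (3∕2) ≠ 0`, the amplitude of
record `A z := C_f z · ∫∫ (u·∏_w archUnitaryValue (m_w) 0 ζ_w)·ARCH₃^{−z}` satisfies **`A (3 ∕ 2) ≠ 0`** in ★ F5's binder bytes — ★ `hA32_of_record` at `m`, `hm := 1 ≤ 2`, `hu := ‖u‖ = 1 ⇒ u ≠ 0`.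
[cite: MoeglinWaldspurger1995, II.1.7, IV.1.11] [cite: Rogawski1990, §13.9 p. 229] [cite: Langlands1976, Appendix] -/
theorem hA32_unitCoupling_of_record (ξ : OneDimAutRepH L) (kμ : InfinitePlace L → ℤ) (hm1 : ∀ w, |kμ w - 2 * ξ.eη w| = 1) (u : ℂ) (hu1 : ‖u‖ = 1)
    (Cf : ℂ → ℂ) (hA32f : Cf (3 / 2) ≠ 0) :
    (fun z : ℂ => Cf z * ∫ Xi : InfiniteAdeleRing L, ∫ a : InfiniteAdeleRing ↥(maximalRealSubfield L),
      (u * ∏ w : InfinitePlace L, archUnitaryValue (kμ w - 2 * ξ.eη w) 0 ((((-(1 + ‖Xi w‖ ^ 2 / 2)) : ℝ) : ℂ) +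
          (((w.embedding δ).im * ((InfiniteAdeleRing.ringEquiv_mixedSpace ↥(maximalRealSubfield L)) a).1 ⟨w.comap (algebraMap ↥(maximalRealSubfield L) L), K2E1HeightBigCellLineFormulaU2.isReal_comap_maximalRealSubfield L w⟩ : ℝ) : ℂ) * Complex.I)) *
        ((((∏ w : InfinitePlace L, ((1 + ‖(Xi) w‖ ^ 2 / 2) ^ 2 + (w δ) ^ 2 * (((InfiniteAdeleRing.ringEquiv_mixedSpace ↥(maximalRealSubfield L)) a).1 ⟨w.comap (algebraMap ↥(maximalRealSubfield L) L), K2E1HeightBigCellLineFormulaU2.isReal_comap_maximalRealSubfield L w⟩) ^ 2))) : ℝ) : ℂ) ^ (-z) ∂μF₁ ∂μE₁) (3 / 2) ≠ 0 :=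
  hA32_of_record L hcδ hδ μE₁ μF₁ (fun w => kμ w - 2 * ξ.eη w) (abs_le_two_of_abs_eq_one hm1) u (ne_zero_of_norm_eq_one hu1) Cf hA32f

end UnitCoupling

end Summit.HodgeConjecture.HodgeConjecture.Cruxes.H413.K2E1ChiArchA32UnitCouplingOfRecordU3

end
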